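import Summits.CriticalPhenomena.PercolationContinuityZ3.Theorems.Transplant.FKConnectivityAllQAntipodalDefs
import HarnessLib

/-!
# Connectivity correlation inequalities for `φ_{w,q}`, every `q > 0` — THREE-MARK PATTERN TABLES (DEFINITIONS): the five
# connection patterns of three marked points, their series / parallel JOIN tables, weighted evaluation of coefficient tables,
# and the `T_sym` member of THEOREM 𝒯₁ with its four gluing certificates

Definitions file (`--supports stmt-CriticalPhenomena-4575`), census lane `prim-bschramm-census` (gen 36) of the post-continuity programme (LANE 2 bschramm, FK sub-lane);
builds on p205010 (kernel theorem, internal audit signed; external expert review pending).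
No named facts, no sorries, nothing probabilistic.  This is Stage S1 (kernel blueprint v1, census g35 memo
`FROM-census-g35-AUDIT-THEOREM-SP.md` §6) of the kernel transcription of the lane's house result THEOREM SP (census g34,
`PROOF-THEOREM-SP.md`): the vocabulary in which the three-mark functionals `T_sym`, `STAR`, … of series–parallel graphs are
evaluated and glued.

* `FK.Pat3` — the five partitions of three marked points `(x, y, s)`: `all`, `xy_s` (`x ~ y`, `s` apart), `xs_y`, `ys_x`,
  `sep`; bits `Pat3.xy/xs/ys`.  `FK.pat3 γ x y s` — the pattern induced by the clusters of the finite configuration `γ`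
  (free count on all of `V`); `FK.conn γ u v` — the classical bit `1{u ↔ v}`.
* JOIN TABLES (census g35 fibre normal form, `fibres_ordered.json`): `FK.joinPar a b` / `FK.corrPar a b` (parallel gluing of a
  two-terminal `(x,y)`-side in class `a = 1{x ↔ y}` with a three-mark `(x,y,s)`-side in pattern `b`; level correction
  `1{x ↔ y on both sides}`), `FK.joinSerL` (series `(x,w)·(w,y,s)`), `FK.joinSerR` (series `(x,w,s)·(w,y)`), `FK.joinSerS`
  (series at the mark `(x,s)·(s,y)`), `FK.corrZero`.  The sibling `…Pat3Gluing.lean` proves that these tables ARE the patterns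
  of glued configurations.
* `FK.tval w E x y s t = ∑_{γ ⊆ E} w(k(γ)+k(E∖γ)) · t(pat γ, pat (E∖γ))` — weighted one-level evaluation of an ORDERED integer
  table `t : Pat3 → Pat3 → ℤ` (weights `1{· = ν}` give census g34's level-`ν` counts `∑ t(P,P′) N_E[ν;P,P′]`, level =
  `k(γ)+k(E∖γ)` up to the constant `|E| − 2|V|`; weights `q^n` give the antipodal sums of `…AntipodalPolar`);
  `FK.lval` — the same for a table with three levels `c = 0,1,2` (read `c` levels up); `FK.fib t join corr a a'` — the FIBRE
  TABLE of `t` over a two-mark side in class `(a, a')`.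
* `FK.tsymTab` — `T_sym = 2n{⊤;⊥} − 2n{xy|s; xs|y} − 2n{xy|s; x|ys} − 2n{xs|y; x|ys}` as a symmetric ordered table;
  `FK.tApexTab` — Conjecture T's polar form `T(x; y, s) = T_sym + 2n{xy|s; xs|y}` (apex = first mark); and the CERTIFICATES
  `FK.tsym_cert_par / serL / serR / serS` (`decide`): in each gluing situation and each class `(a,a')` of the two-mark side, the
  fibre of `T_sym` plus the fibre of the swapped class dominates, after transposition-symmetrisation, `μ · T_sym` placed `k`
  levels up (`FK.muPar/kPar/muSer/kSer`; census g35 audit6/blueprint: PAR `JJ` termwise, `AA ≥ T_sym`, `JA+AJ ≥ T_sym` one level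
  up; SER `JJ ≥ T_sym`, `AA` termwise, `JA+AJ ≥ T_sym`; SER at the mark termwise after symmetrising one side).
The induction itself (THEOREM 𝒯₁ for `T_sym`: `tval w E x y s T_sym ≥ 0` on every two-terminal series–parallel network with an
inner third mark) is `…TsymSP.lean`, over `…Pat3Gluing.lean` and `…Pat3Functionals.lean`.
[cite: AyyerLinussonRavichandran2025, §7 eq. (13)–(15) (p. 22)] [cite: Grimmett2006, §1.4 eq. (1.20) (p. 15); §3.8 (pp. 61–62)]
-/

namespace Summit.CriticalPhenomena.PercolationContinuityZ3.Theorems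

namespace FK

open SimpleGraph Literature.Probability.LatticeModels Literature.Probability.Percolation

/-! ### The five connection patterns of three marked points -/

/-- The five partitions of three marked points `(x, y, s)` induced by the clusters of a configuration:
`all` (one cluster), `xy_s` (`x ~ y`, `s` apart), `xs_y`, `ys_x`, `sep` (pairwise apart). [folklore] -/
inductive Pat3 : Type
  | all | xy_s | xs_y | ys_x | sep
  deriving DecidableEq

namespace Pat3

/-- The five patterns, as a finite type (for `decide`). [folklore] -/
instance : Fintype Pat3 :=
  ⟨{all, xy_s, xs_y, ys_x, sep}, by intro p; cases p <;> simp⟩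

/-- `x ~ y` in the pattern. [folklore] -/
def xy : Pat3 → Bool
  | all => true | xy_s => true | _ => false

/-- `x ~ s` in the pattern. [folklore] -/
def xs : Pat3 → Bool
  | all => true | xs_y => true | _ => false

/-- `y ~ s` in the pattern. [folklore] -/
def ys : Pat3 → Bool
  | all => true | ys_x => true | _ => false

/-- A pattern is determined by its three pair-connection bits. [folklore] -/
theorem ext_bools {P Q : Pat3} (h₁ : P.xy = Q.xy) (h₂ : P.xs = Q.xs) (h₃ : P.ys = Q.ys) : P = Q := by
  revert P Q h₁ h₂ h₃; decide

end Pat3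

open scoped Classical

variable {V : Type*}

/-- The connection pattern `pat3 γ x y s` of the three marked points `x, y, s` in the open graph of the finite configuration
`γ` (clusters counted on all of `V`). [folklore] -/
noncomputable def pat3 (γ : Finset (Sym2 V)) (x y s : V) : Pat3 :=
  if (openGraph (↑γ : BondConfig V)).Reachable x y then
    (if (openGraph (↑γ : BondConfig V)).Reachable x s then Pat3.all else Pat3.xy_s)
  else if (openGraph (↑γ : BondConfig V)).Reachable x s then Pat3.xs_y
  else if (openGraph (↑γ : BondConfig V)).Reachable y s then Pat3.ys_x else Pat3.sep

/-- The connection bit `conn γ u v = 1{u ↔ v in the open graph of γ}` (classical `Bool`). [folklore] -/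
noncomputable def conn (γ : Finset (Sym2 V)) (u v : V) : Bool :=
  @decide ((openGraph (↑γ : BondConfig V)).Reachable u v) (Classical.propDecidable _)

/-- `conn` is the indicator of `u ↔ v`. [folklore] -/
theorem conn_iff (γ : Finset (Sym2 V)) (u v : V) : conn γ u v = true ↔ (openGraph (↑γ : BondConfig V)).Reachable u v := by
  unfold conn
  exact decide_eq_true_iff

/-- `conn` on a connected pair. [folklore] -/
theorem conn_of_reachable {γ : Finset (Sym2 V)} {u v : V} (h : (openGraph (↑γ : BondConfig V)).Reachable u v) :
    conn γ u v = true := (conn_iff γ u v).2 h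

/-- `conn` on a disconnected pair. [folklore] -/
theorem conn_of_not_reachable {γ : Finset (Sym2 V)} {u v : V} (h : ¬ (openGraph (↑γ : BondConfig V)).Reachable u v) :
    conn γ u v = false := by
  cases hc : conn γ u v
  · rfl
  · exact absurd ((conn_iff γ u v).1 hc) h

/-- The `x ~ y` bit of the pattern is the connection `x ↔ y`. [folklore] -/
theorem pat3_xy (γ : Finset (Sym2 V)) (x y s : V) :
    (pat3 γ x y s).xy = conn γ x y := by
  unfold conn
  unfold pat3
  by_cases hxy : (openGraph (↑γ : BondConfig V)).Reachable x y <;>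
  by_cases hxs : (openGraph (↑γ : BondConfig V)).Reachable x s <;>
  by_cases hys : (openGraph (↑γ : BondConfig V)).Reachable y s <;>
  simp [hxy, hxs, hys, Pat3.xy]

/-- The `x ~ s` bit of the pattern is the connection `x ↔ s`. [folklore] -/
theorem pat3_xs (γ : Finset (Sym2 V)) (x y s : V) :
    (pat3 γ x y s).xs = conn γ x s := by
  unfold conn
  unfold pat3
  by_cases hxy : (openGraph (↑γ : BondConfig V)).Reachable x y <;>
  by_cases hxs : (openGraph (↑γ : BondConfig V)).Reachable x s <;>
  by_cases hys : (openGraph (↑γ : BondConfig V)).Reachable y s <;>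
  simp [hxy, hxs, hys, Pat3.xs]

/-- The `y ~ s` bit of the pattern is the connection `y ↔ s` (transitivity of `↔`). [folklore] -/
theorem pat3_ys (γ : Finset (Sym2 V)) (x y s : V) :
    (pat3 γ x y s).ys = conn γ y s := by
  unfold conn
  unfold pat3
  by_cases hxy : (openGraph (↑γ : BondConfig V)).Reachable x y <;>
  by_cases hxs : (openGraph (↑γ : BondConfig V)).Reachable x s <;>
  by_cases hys : (openGraph (↑γ : BondConfig V)).Reachable y s <;>
  simp [hxy, hxs, hys, Pat3.ys]
  · exact hys (hxy.symm.trans hxs)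
  · exact hxs (hxy.trans hys)
  · exact hxy (hxs.trans hys.symm)

/-- The bits of `pat3` as propositions. [folklore] -/
theorem pat3_xy_iff (γ : Finset (Sym2 V)) (x y s : V) :
    (pat3 γ x y s).xy = true ↔ (openGraph (↑γ : BondConfig V)).Reachable x y := by
  rw [pat3_xy, conn_iff]

/-- The bits of `pat3` as propositions. [folklore] -/
theorem pat3_xs_iff (γ : Finset (Sym2 V)) (x y s : V) :
    (pat3 γ x y s).xs = true ↔ (openGraph (↑γ : BondConfig V)).Reachable x s := by
  rw [pat3_xs, conn_iff]

/-- The bits of `pat3` as propositions. [folklore] -/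
theorem pat3_ys_iff (γ : Finset (Sym2 V)) (x y s : V) :
    (pat3 γ x y s).ys = true ↔ (openGraph (↑γ : BondConfig V)).Reachable y s := by
  rw [pat3_ys, conn_iff]

/-- A pattern is identified by three connection facts. [folklore] -/
theorem pat3_eq_of_iff {γ : Finset (Sym2 V)} {x y s : V} {P : Pat3}
    (hxy : (openGraph (↑γ : BondConfig V)).Reachable x y ↔ P.xy = true)
    (hxs : (openGraph (↑γ : BondConfig V)).Reachable x s ↔ P.xs = true)
    (hys : (openGraph (↑γ : BondConfig V)).Reachable y s ↔ P.ys = true) : pat3 γ x y s = P := by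
  apply Pat3.ext_bools
  · rw [pat3_xy]
    by_cases h : (openGraph (↑γ : BondConfig V)).Reachable x y
    · rw [conn_of_reachable h, (hxy.1 h)]
    · rw [conn_of_not_reachable h]
      cases hb : P.xy
      · rfl
      · exact absurd (hxy.2 hb) h
  · rw [pat3_xs]
    by_cases h : (openGraph (↑γ : BondConfig V)).Reachable x s
    · rw [conn_of_reachable h, (hxs.1 h)]
    · rw [conn_of_not_reachable h]
      cases hb : P.xs
      · rfl
      · exact absurd (hxs.2 hb) h
  · rw [pat3_ys]
    by_cases h : (openGraph (↑γ : BondConfig V)).Reachable y s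
    · rw [conn_of_reachable h, (hys.1 h)]
    · rw [conn_of_not_reachable h]
      cases hb : P.ys
      · rfl
      · exact absurd (hys.2 hb) h

/-! ### Join tables of the four gluing situations -/

/-- PARALLEL join: pattern on `(x, y, s)` of `γ_A ∪ γ_B` from the bit `a = 1{x ↔ y in γ_A}` of the two-terminal side and the
pattern `b` of the three-mark side (both sides with terminals `x, y`; `s` inner in the `B` side). [folklore] -/
def joinPar : Bool → Pat3 → Pat3
  | false, b => b
  | true, Pat3.all => Pat3.all
  | true, Pat3.xy_s => Pat3.xy_s
  | true, Pat3.xs_y => Pat3.all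
  | true, Pat3.ys_x => Pat3.all
  | true, Pat3.sep => Pat3.xy_s

/-- Level correction of the parallel join: `1{x ↔ y on both sides}`. [folklore] -/
def corrPar : Bool → Pat3 → ℕ
  | true, Pat3.all => 1
  | true, Pat3.xy_s => 1
  | _, _ => 0

/-- SERIES join `(x,w) · (w,y,s)`: pattern on `(x, y, s)` from `a = 1{x ↔ w in γ_A}` and the pattern `b` of `γ_B` on `(w, y, s)`.
[folklore] -/
def joinSerL : Bool → Pat3 → Pat3
  | true, b => b
  | false, Pat3.all => Pat3.ys_x
  | false, Pat3.ys_x => Pat3.ys_x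
  | false, _ => Pat3.sep

/-- SERIES join `(x,w,s) · (w,y)`: pattern on `(x, y, s)` from the pattern `b` of `γ_B` on `(x, w, s)` and `a = 1{w ↔ y in γ_A}`.
[folklore] -/
def joinSerR : Bool → Pat3 → Pat3
  | true, b => b
  | false, Pat3.all => Pat3.xs_y
  | false, Pat3.xs_y => Pat3.xs_y
  | false, _ => Pat3.sep

/-- SERIES join at the mark, `(x,s) · (s,y)`: pattern on `(x, y, s)` from `a = 1{x ↔ s in γ_A}`, `b = 1{s ↔ y in γ_B}`. [folklore] -/
def joinSerS : Bool → Bool → Pat3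
  | true, true => Pat3.all
  | true, false => Pat3.xs_y
  | false, true => Pat3.ys_x
  | false, false => Pat3.sep

/-- No level correction (series joins). [folklore] -/
def corrZero : Bool → Pat3 → ℕ := fun _ _ => 0

/-- Bit `x ~ y` of the parallel join. [folklore] -/
theorem joinPar_xy (a : Bool) (b : Pat3) : (joinPar a b).xy = (a || b.xy) := by revert a b; decide

/-- Bit `x ~ s` of the parallel join. [folklore] -/
theorem joinPar_xs (a : Bool) (b : Pat3) : (joinPar a b).xs = (b.xs || (a && b.ys)) := by revert a b; decide

/-- Bit `y ~ s` of the parallel join. [folklore] -/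
theorem joinPar_ys (a : Bool) (b : Pat3) : (joinPar a b).ys = (b.ys || (a && b.xs)) := by revert a b; decide

/-- Bit `x ~ y` of the series join (mark in the second part). [folklore] -/
theorem joinSerL_xy (a : Bool) (b : Pat3) : (joinSerL a b).xy = (a && b.xy) := by revert a b; decide

/-- Bit `x ~ s` of the series join (mark in the second part). [folklore] -/
theorem joinSerL_xs (a : Bool) (b : Pat3) : (joinSerL a b).xs = (a && b.xs) := by revert a b; decide

/-- Bit `y ~ s` of the series join (mark in the second part). [folklore] -/
theorem joinSerL_ys (a : Bool) (b : Pat3) : (joinSerL a b).ys = b.ys := by revert a b; decide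

/-- Bit `x ~ y` of the series join (mark in the first part). [folklore] -/
theorem joinSerR_xy (a : Bool) (b : Pat3) : (joinSerR a b).xy = (b.xy && a) := by revert a b; decide

/-- Bit `x ~ s` of the series join (mark in the first part). [folklore] -/
theorem joinSerR_xs (a : Bool) (b : Pat3) : (joinSerR a b).xs = b.xs := by revert a b; decide

/-- Bit `y ~ s` of the series join (mark in the first part). [folklore] -/
theorem joinSerR_ys (a : Bool) (b : Pat3) : (joinSerR a b).ys = (a && b.ys) := by revert a b; decide

/-- Bit `x ~ y` of the series join at the mark. [folklore] -/
theorem joinSerS_xy (a b : Bool) : (joinSerS a b).xy = (a && b) := by revert a b; decide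

/-- Bit `x ~ s` of the series join at the mark. [folklore] -/
theorem joinSerS_xs (a b : Bool) : (joinSerS a b).xs = a := by revert a b; decide

/-- Bit `y ~ s` of the series join at the mark. [folklore] -/
theorem joinSerS_ys (a b : Bool) : (joinSerS a b).ys = b := by revert a b; decide

/-! ### Weighted evaluation of coefficient tables; fibre tables -/

section Eval

variable (w : ℕ → ℝ) (E : Finset (Sym2 V)) (x y s : V)

/-- **Weighted one-level evaluation** of an (ordered) coefficient table `t : Pat3 → Pat3 → ℤ` on the three-mark network
`(E; x, y, s)`: `tval w E x y s t = ∑_{γ ⊆ E} w(k(γ) + k(E ∖ γ)) · t(pat γ, pat (E ∖ γ))`.  With `w = 1{· = ν}` this is the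
level-`ν` count `∑_{(P,P')} t(P,P') · N_E[ν; P, P']` of census g34's tables (level = `k(γ)+k(E∖γ)` up to the constant
`|E| - 2|V|`); with `w(n) = q^n` it is the `q`-weighted antipodal sum. [folklore] -/
noncomputable def tval (t : Pat3 → Pat3 → ℤ) : ℝ :=
  ∑ γ ∈ E.powerset, w (apExp E γ) * (t (pat3 γ x y s) (pat3 (E \ γ) x y s) : ℝ)

/-- **Weighted multilevel evaluation** of a table `F : ℕ → Pat3 → Pat3 → ℤ` with levels `c = 0, 1, 2`
(`F c` is read one level up per unit of `c`): `lval w E x y s F = ∑_{γ ⊆ E} ∑_{c < 3} w(k(γ)+k(E∖γ)+c) · F c (pat γ) (pat (E∖γ))`.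
[folklore] -/
noncomputable def lval (F : ℕ → Pat3 → Pat3 → ℤ) : ℝ :=
  ∑ γ ∈ E.powerset, ∑ c ∈ Finset.range 3, w (apExp E γ + c) * (F c (pat3 γ x y s) (pat3 (E \ γ) x y s) : ℝ)

end Eval

/-- **Fibre table** of the one-level table `t` over a two-mark side in class `(a, a')` (bits of `γ_A` and of its complement):
the three-mark side's configuration `γ_B` with patterns `(P, Q)` contributes `t(join a P, join a' Q)` at level
`corr a P + corr a' Q`. [folklore] -/
def fib (t : Pat3 → Pat3 → ℤ) (join : Bool → Pat3 → Pat3) (corr : Bool → Pat3 → ℕ) (a a' : Bool) :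
    ℕ → Pat3 → Pat3 → ℤ :=
  fun c P Q => if corr a P + corr a' Q = c then t (join a P) (join a' Q) else 0

/-! ### The `T_sym` member and its gluing certificates -/

/-- **The `T_sym` table** (census g25/g34, PROOF-THEOREM-SP §1.3, in ORDERED symmetric form): `+1` on the two ordered pairs
`{all, sep}`, `-1` on the six ordered pairs of distinct two-block patterns, `0` elsewhere; so that
`∑_{γ ⊆ E} T_sym(pat γ, pat (E∖γ)) · 1{level ν} = 2n{⊤;⊥} − 2n{xy|s; xs|y} − 2n{xy|s; x|ys} − 2n{xs|y; x|ys}` at level `ν`.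
[cite: AyyerLinussonRavichandran2025, §7 (p. 22)] -/
def tsymTab : Pat3 → Pat3 → ℤ
  | Pat3.all, Pat3.sep => 1
  | Pat3.sep, Pat3.all => 1
  | Pat3.xy_s, Pat3.xs_y => -1
  | Pat3.xs_y, Pat3.xy_s => -1
  | Pat3.xy_s, Pat3.ys_x => -1
  | Pat3.ys_x, Pat3.xy_s => -1
  | Pat3.xs_y, Pat3.ys_x => -1
  | Pat3.ys_x, Pat3.xs_y => -1
  | _, _ => 0

/-- **The apex table** (apex = the FIRST positional mark): Conjecture T's polar form `Q(ω, ω')` of `…AntipodalPolar` read on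
patterns, `T(x; y, s) = T_sym + 2n{xy|s; xs|y}`: `+1` on `{all, sep}`, `-1` on the ordered pairs `{x|ys ; xy|s}` and `{x|ys ; xs|y}`.
[cite: AyyerLinussonRavichandran2025, §7 (p. 22)] -/
def tApexTab : Pat3 → Pat3 → ℤ
  | Pat3.all, Pat3.sep => 1
  | Pat3.sep, Pat3.all => 1
  | Pat3.ys_x, Pat3.xy_s => -1
  | Pat3.ys_x, Pat3.xs_y => -1
  | Pat3.xy_s, Pat3.ys_x => -1
  | Pat3.xs_y, Pat3.ys_x => -1
  | _, _ => 0

/-- `T_sym ≤ T(apex)` coefficientwise (`T − T_sym = 2n{xy|s; xs|y} ≥ 0`). [folklore] -/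
theorem tsymTab_le_tApexTab : ∀ P Q : Pat3, tsymTab P Q ≤ tApexTab P Q := by decide

/-- Multipliers of the PARALLEL certificate for `T_sym`, per class of the two-mark side. [folklore] -/
def muPar : Bool → Bool → ℕ
  | true, true => 0
  | true, false => 1
  | false, true => 1
  | false, false => 2

/-- Levels of the PARALLEL certificate for `T_sym`. [folklore] -/
def kPar : Bool → Bool → ℕ
  | true, false => 1
  | false, true => 1
  | _, _ => 0

/-- Multipliers of the SERIES certificates for `T_sym`. [folklore] -/
def muSer : Bool → Bool → ℕ
  | true, true => 2
  | true, false => 1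
  | false, true => 1
  | false, false => 0

/-- Levels of the SERIES certificates for `T_sym` (all `0`). [folklore] -/
def kSer : Bool → Bool → ℕ := fun _ _ => 0

/-- **PARALLEL certificate for `T_sym`** (census g35 fibre normal form, `T_sym` rows of PAR(2|3): class `JJ` termwise,
`AA ≥ T_sym`, `JA+AJ ≥ T_sym` one level up), checked by `decide`. [folklore] -/
theorem tsym_cert_par : ∀ a a' : Bool, ∀ c < 3, ∀ P Q : Pat3,
    (muPar a a' : ℤ) * ((if c = kPar a a' then tsymTab P Q else 0) + (if c = kPar a a' then tsymTab Q P else 0)) ≤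
      (fib tsymTab joinPar corrPar a a' c P Q + fib tsymTab joinPar corrPar a' a c P Q) +
        (fib tsymTab joinPar corrPar a a' c Q P + fib tsymTab joinPar corrPar a' a c Q P) := by
  decide

/-- **SERIES certificate for `T_sym`, mark in the second part** (`T_sym` rows of SER(2|3): `JJ ≥ T_sym`, `AA` termwise,
`JA+AJ ≥ T_sym`), checked by `decide`. [folklore] -/
theorem tsym_cert_serL : ∀ a a' : Bool, ∀ c < 3, ∀ P Q : Pat3,
    (muSer a a' : ℤ) * ((if c = kSer a a' then tsymTab P Q else 0) + (if c = kSer a a' then tsymTab Q P else 0)) ≤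
      (fib tsymTab joinSerL corrZero a a' c P Q + fib tsymTab joinSerL corrZero a' a c P Q) +
        (fib tsymTab joinSerL corrZero a a' c Q P + fib tsymTab joinSerL corrZero a' a c Q P) := by
  decide

/-- **SERIES certificate for `T_sym`, mark in the first part** (`T_sym` rows of SER(3|2)), checked by `decide`. [folklore] -/
theorem tsym_cert_serR : ∀ a a' : Bool, ∀ c < 3, ∀ P Q : Pat3,
    (muSer a a' : ℤ) * ((if c = kSer a a' then tsymTab P Q else 0) + (if c = kSer a a' then tsymTab Q P else 0)) ≤
      (fib tsymTab joinSerR corrZero a a' c P Q + fib tsymTab joinSerR corrZero a' a c P Q) +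
        (fib tsymTab joinSerR corrZero a a' c Q P + fib tsymTab joinSerR corrZero a' a c Q P) := by
  decide

/-- **SERIES-at-the-mark certificate for `T_sym`** (SERs(2|2): the bilinear form vanishes after symmetrising one side),
checked by `decide`. [folklore] -/
theorem tsym_cert_serS : ∀ a a' b b' : Bool,
    0 ≤ tsymTab (joinSerS a b) (joinSerS a' b') + tsymTab (joinSerS a b') (joinSerS a' b) := by
  decide

end FK

end Summit.CriticalPhenomena.PercolationContinuityZ3.Theorems
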